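import Summits.QuantumFields.BalabanUV.T4Continuum.Support.B16HistoryTowerEndLWRP82
import Summits.QuantumFields.BalabanUV.T4Continuum.Support.B16HistoryTowerEndPrintedRRange
import Summits.QuantumFields.BalabanUV.T4Continuum.Spine.NE7c.LiveFactorEndLetters

/-!
# `T4Continuum.Spine.NE7c.LiveFactorEndApplied` — spine estimate NE7c (node U5b), road (δ) THRESHOLD RANDOMISATION:
# the NE7b lineage's END AT THE TOWER of record (`B16HistoryTowerEndLWRP82`, renewal pin at print's ROUNDED letter,
# OWNER RULING45) APPLIED AT THE LOWERED-THRESHOLD RUN's LETTERS — one moved letter `γ₀ ↦ λ₀²γ₀`, one `exact`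
# (cell `pub-balaban-gaps`, track G2, seat ne8 gen 6, file 9; record `HOME/ne/NE7c.md` §13)

HONEST FRAMING.  Finite four-torus programme, rung (B)+1 only — NOT infinite volume, NOT a mass gap, NOT the Clay
problem, NOT summit progress, NOT a proof of NE7c (`T4IndicatorShell.ShellWeightBound`, INSTANCE 0∕1, which waits on
node O) and NOT a proof of NE7b (`T4WeightBudget.RelWeightBound`, NOT PRINTED, NOT PROVED).  Nothing of
[Bałaban 1983–89] is asserted beyond print: the END's terminal theorem `continuumYM4Torus_of_towerReadingLWR_fsc`
(t4-ne7b-p1 g101, in the tree since 2026-08-23T01:47Z) is CITED BY NAME and instantiated; its tower record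
`TowerReadDataLWR` remains a displayed HYPOTHESIS (here: a record OF THE LOWERED-THRESHOLD RUN, node O's to build exactly
as for print's run); the two side conditions that see the moved letter come from the companion `LiveFactorEndLetters`
(p348273).  CONDITIONAL on everything the live record displays; count 0∕9 — unchanged.

CONTENT.  Road (δ)'s lowered-threshold run moves ONE letter of the END, `O ↦ {O with γ₀ := λ₀²γ₀}`, with the count's
quadratic birth constant and the two slacks riding along (`C ↦ {C with a := λ₀²a}`, `θ ↦ λ₀²θ`, `θv ↦ λ₀²θv`;
`LiveFactorEndLetters` §§1–2).  Under the owner's ♭-re-cut the END's renewal pin is print's ROUNDED letter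
`sRrnd D O p₁ g₀ R K h = (R^K_h)^{−(d+5)}·(ℓ^K_h)^{2p₁}`, which does not see `γ₀` (`sRrnd_live`, `rfl`): the live record
differs from print's in its BIRTH floor `hsB` (`λ₀²·sBsharp`, `LiveFactorEndLetters.sBsharp_live`), its sign row `hγ₀`
and the count's `a` only.  §2 fills the live record's `sB ∕ hw ∕ hsB` slots ON THE NOSE from the owner's 3R
(`hw_of_stepDisplays_rounded_of_hvol` at the one-letter live `c`, whose `StepDisplaysAt` input `LiveFactorRoundedRenewal`
supplies; the renewal-letter tables are blind to `γ₀`; also ON THE PERFORMED RANGE `j < K` via leaf-02's 3R-range,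
p349246) and from part 3's standing table lemma `hsB_of_tables` (× `λ₀²`).
§3 `continuumYM4Torus_of_towerReadingLWR_live`: the END's theorem with its constants-only side
conditions AT PRINT's LETTERS and a live tower record for all small couplings ⟹ `ContinuumYM4Torus D`.  NET: (L1-step) in
the END's currency = instantiation; every «g small» the END needs at the live letters is produced inside it from
`ForSmallCouplings`.  VERDICT of `HOME/ne/NE7c.md` UNCHANGED: WORK-bound behind node O.  HONEST DEPENDENCY (cell):
continuum YM on T⁴ ⇐ BetaPertH ∧ nine spine estimates (0∕9 proved); BetaPertH ⇐ (D1) ∧ (D4) ∧ CAP+tail.  This file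
changes none of it.
-/

open MeasureTheory
open Literature.MathematicalPhysics.QuantumFieldTheory.Balaban1983to89
open T4PrintedShapeBanking T4CanonicalMenus T4Continuum
open Summit.QuantumFields.BalabanUV.T4Continuum.HistoryConstants
open Summit.QuantumFields.BalabanUV.T4Continuum.HistoryZoneEvolve (cth)
open Summit.QuantumFields.BalabanUV.T4Continuum.CountThresholdUniform
open Literature.MathematicalPhysics.QuantumFieldTheory.Balaban1983to89.B16StepFactorsPrinted
open Literature.MathematicalPhysics.QuantumFieldTheory.Balaban1983to89.B16LargeFieldFactors380 (minConst)
open Summit.QuantumFields.BalabanUV.T4Continuum.B16HistoryIndexedRepr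
open Summit.QuantumFields.BalabanUV.T4Continuum.B16HistoryReprChain
open Summit.QuantumFields.BalabanUV.T4Continuum.B16HistoryReprInstance
open Summit.QuantumFields.BalabanUV.T4Continuum.B16HistoryReprReadCausal
open Summit.QuantumFields.BalabanUV.T4Continuum.B16HistoryStepDisplayPinned
open Summit.QuantumFields.BalabanUV.T4Continuum.B16HistoryStepJunction
open Summit.QuantumFields.BalabanUV.T4Continuum.B16HistoryTowerEndDataLWL
open Summit.QuantumFields.BalabanUV.T4Continuum.B16HistoryTowerEndPrinted
open Summit.QuantumFields.BalabanUV.T4Continuum.B16HistoryTowerEndPrintedR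
open Summit.QuantumFields.BalabanUV.T4Continuum.B16HistoryTowerEndPrintedRRange
open Summit.QuantumFields.BalabanUV.T4Continuum.HistoryBankingSharpShares (ell)
open Summit.QuantumFields.BalabanUV.T4Continuum.B16HistoryTowerEndDataLWR
open Summit.QuantumFields.BalabanUV.T4Continuum.B16HistoryTowerEndLWRP82
open Summit.QuantumFields.BalabanUV.T4Continuum.Spine.NE7c.LiveFactorEndLetters

namespace Summit.QuantumFields.BalabanUV.T4Continuum.Spine.NE7c.LiveFactorEndApplied

noncomputable section

section Letters

variable {F : T4Family} {G : Type*} [GaugeGroup G] [MeasurableSpace G] [HaarData G] {lam₀ : ℝ}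

/-- **THE END's RENEWAL PIN OF RECORD DOES NOT SEE THE MOVED LETTER**: print's rounded letter `(R_h^{d+5})⁻¹·(ℓ_h^{p₁})²`
at the live `O` is the same function (`rfl` — it reads `O.d` only). [folklore] -/
theorem sRrnd_live (D : FiniteEpsData F G) (O : PrintedO1s) (p₁ : ℕ) (g₀ : ℕ → ℝ) (R : ℕ → ℕ → ℕ) :
    sRrnd D { O with γ₀ := lam₀ ^ 2 * O.γ₀ } p₁ g₀ R = sRrnd D O p₁ g₀ R :=
  rfl

/-- the live record's birth floor is `λ₀²`-times print's (`LiveFactorEndLetters.sBsharp_live`, restated at the record's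
run `D.C ⟨K, F.m, g₀ K⟩` for the reader of `TowerReadDataLWR.hsB`) [folklore] -/
theorem hsB_floor_live (D : FiniteEpsData F G) (O : PrintedO1s) (m : ℝ) (C : T4PrintedShapeBanking.Consts)
    (g₀ : ℕ → ℝ) (K j d' : ℕ) :
    HistoryBankingSharpShares.sBsharp { O with γ₀ := lam₀ ^ 2 * O.γ₀ } m C (D.C ⟨K, F.m, g₀ K⟩).flow.g j d' =
      lam₀ ^ 2 * HistoryBankingSharpShares.sBsharp O m C (D.C ⟨K, F.m, g₀ K⟩).flow.g j d' :=
  sBsharp_live O m C _ j d'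

end Letters

/-! ## §2. The live record's `sB ∕ hw ∕ hsB` slots from the owner's 3R and part 3's table lemma, at the one-letter live `c` -/

section Slots

variable {F : T4Family} {G : Type*} [GaugeGroup G] [MeasurableSpace G] [HaarData G]
  (D : FiniteEpsData F G) (O : PrintedO1s) (p₁ : ℕ) (g₀ : ℕ → ℝ)
  {P : Type} {d : ℕ} {X : ℕ → ℕ → Type} {𝒢 : (K j : ℕ) → GoodClass (X K j)}
  (T : (K : ℕ) → Tower P (X K) (𝒢 K)) (𝒮 : StepReading P d) (c : B16StepFactorsPrinted.Consts)
  (Xs : (K j : ℕ) → (Fin j → P) → StepData d P) (cΛ M : ℝ) {lam₀ : ℝ}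

/-- **THE LIVE RECORD's `hw` SLOT, ON THE NOSE** (the owner's 3R `hw_of_stepDisplays_rounded_of_hvol` at the one-letter live
`c`): the LIVE step sentences at the process carriers in the END-compatible convention — `StepDisplaysAt (runsOf D g₀ K) j
(carriersOf …) {c with γ₀ := λ₀²γ₀}`, inhabited by `LiveFactorRoundedRenewal.stepDisplaysAt_live_oneLetter` —, J4's `=` class
junction, the volume side `hvol`, and print's three renewal-letter tables (`c.d = O.d`, `R(g^K_h) = R_h`, `P1(g^K_h) = ℓ_h^{p₁}` — all
blind to `γ₀`) give `HwPinned T 𝒮 (λ₀²·sBsharp (runsOf D g₀) c) (sRrnd D {O with γ₀ := λ₀²γ₀} p₁ g₀ 𝒮.R) cΛ M (gsOf D g₀) K₀` — the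
TYPE of the live record's `TowerReadDataLWR.hw` at `sB := λ₀²·sBsharp (runsOf D g₀) c`, renewal pin UNCHANGED. [folklore] -/
theorem hw_live_of_stepDisplays_rounded_of_hvol {K₀ : ℕ} (hc : 0 ≤ cΛ) (hM : 0 ≤ M)
    (hℓ : ∀ K j, j ≤ K → 0 ≤ ell (gsOf D g₀ K) j)
    (hdisp : ∀ K, K₀ ≤ K → ∀ (j : ℕ) (g : Fin j → P),
      StepDisplaysAt (runsOf D g₀ K) j (carriersOf T 𝒮 (runsOf D g₀ K) K j g (Xs K j g)) { c with γ₀ := lam₀ ^ 2 * c.γ₀ })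
    (hclass : ∀ K, K₀ ≤ K → ∀ (j : ℕ) (g : Fin j → P) (p : P),
      ∀ x ∈ (𝒮.runPartial K (j + 1) (Fin.snoc g p)).histM.newPairs (j + 1),
        (Xs K j g).dC p x = (𝒮.κ K ((𝒮.runPartial K (j + 1) (Fin.snoc g p)).histM.newAt (j + 1) x) : ℝ))
    (hvol : ∀ K, K₀ ≤ K → ∀ (j : ℕ) (g : Fin j → P) (p : P),
      (Xs K j g).gInt p * (Xs K j g).aInt p * (Xs K j g).vfac p ≤
        ∏ cc ∈ (𝒮.runPartial K (j + 1) (Fin.snoc g p)).histM.comp (j + 1),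
          ΛexpL cΛ M d (gsOf D g₀) 𝒮.R K (j + 1) ^ (cc.2).card)
    (hd : c.d = O.d) (hR : ∀ K h, c.R (gsOf D g₀ K h) = (𝒮.R K h : ℝ))
    (hP : ∀ K h, c.P1 (gsOf D g₀ K h) = ell (gsOf D g₀ K) h ^ p₁) :
    HwPinned T 𝒮 (fun K j d' => lam₀ ^ 2 * B16HistoryStepJunction.sBsharp (runsOf D g₀) c K j d')
      (sRrnd D { O with γ₀ := lam₀ ^ 2 * O.γ₀ } p₁ g₀ 𝒮.R) cΛ M (gsOf D g₀) K₀ := by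
  have h := hw_of_stepDisplays_rounded_of_hvol D O p₁ g₀ T 𝒮 { c with γ₀ := lam₀ ^ 2 * c.γ₀ } Xs cΛ M hc hM hℓ hdisp hclass
    hvol hd hR hP
  rw [junction_sBsharp_live₁] at h
  exact h

/-- **THE LIVE RECORD's `hw` SLOT ON THE PERFORMED RANGE** (leaf-02's 3R-range `hw_of_stepDisplays_rounded_of_hvol_range`, p349246,
at the one-letter live `c`): as above with (A)'s convention (β) as the tower-side display `hβ` («the step map past the cutoff kills
the unit») and the live sentences, class junction and volume side asked ONLY for the performed operations `j < K`. [folklore] -/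
theorem hw_live_of_stepDisplays_rounded_of_hvol_range {K₀ : ℕ} (hc : 0 ≤ cΛ) (hM : 0 ≤ M)
    (hℓ : ∀ K j, j ≤ K → 0 ≤ ell (gsOf D g₀ K) j)
    (hβ : ∀ K, K₀ ≤ K → ∀ j, K ≤ j → ∀ (g : Fin j → P) (p : P) (x : X K (j + 1)),
      ((T K).op j g p).T (fun _ => 1) x = 0)
    (hdisp : ∀ K, K₀ ≤ K → ∀ j, j < K → ∀ (g : Fin j → P),
      StepDisplaysAt (runsOf D g₀ K) j (carriersOf T 𝒮 (runsOf D g₀ K) K j g (Xs K j g)) { c with γ₀ := lam₀ ^ 2 * c.γ₀ })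
    (hclass : ∀ K, K₀ ≤ K → ∀ j, j < K → ∀ (g : Fin j → P) (p : P),
      ∀ x ∈ (𝒮.runPartial K (j + 1) (Fin.snoc g p)).histM.newPairs (j + 1),
        (Xs K j g).dC p x = (𝒮.κ K ((𝒮.runPartial K (j + 1) (Fin.snoc g p)).histM.newAt (j + 1) x) : ℝ))
    (hvol : ∀ K, K₀ ≤ K → ∀ j, j < K → ∀ (g : Fin j → P) (p : P),
      (Xs K j g).gInt p * (Xs K j g).aInt p * (Xs K j g).vfac p ≤
        ∏ cc ∈ (𝒮.runPartial K (j + 1) (Fin.snoc g p)).histM.comp (j + 1),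
          ΛexpL cΛ M d (gsOf D g₀) 𝒮.R K (j + 1) ^ (cc.2).card)
    (hd : c.d = O.d) (hR : ∀ K h, c.R (gsOf D g₀ K h) = (𝒮.R K h : ℝ))
    (hP : ∀ K h, c.P1 (gsOf D g₀ K h) = ell (gsOf D g₀ K) h ^ p₁) :
    HwPinned T 𝒮 (fun K j d' => lam₀ ^ 2 * B16HistoryStepJunction.sBsharp (runsOf D g₀) c K j d')
      (sRrnd D { O with γ₀ := lam₀ ^ 2 * O.γ₀ } p₁ g₀ 𝒮.R) cΛ M (gsOf D g₀) K₀ := by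
  have h := hw_of_stepDisplays_rounded_of_hvol_range D O p₁ g₀ T 𝒮 { c with γ₀ := lam₀ ^ 2 * c.γ₀ } Xs cΛ M hc hM hℓ hβ
    hdisp hclass hvol hd hR hP
  rw [junction_sBsharp_live₁] at h
  exact h

/-- **THE LIVE RECORD's `hsB` FLOOR** at `sB := λ₀²·sBsharp (runsOf D g₀) c`: part 3's birth-letter table lemma `hsB_of_tables`
(the count road's booked `γ₀·m·p₀²·(d′+1)` below print's `γ₀·min{…}·p₀²·(d′+1)` under `c.γ₀ = O.γ₀`, `c.A₀ = C.A₀`, `c.p₀ = C.p₀`,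
`m ≤ min{½B₃⁻²A₀², 2A₁², A₁²}`) multiplied by `λ₀²` — the live `O`'s floor against the live `sB`. [folklore] -/
theorem hsB_live_of_tables (m : ℝ) (C : T4PrintedShapeBanking.Consts) (hγ : c.γ₀ = O.γ₀) (hA : c.A₀ = C.A₀) (hp : c.p₀ = C.p₀)
    (hγ0 : 0 ≤ O.γ₀) (hm : m ≤ minConst c.B₃ c.A₀ c.A₁) (K j d' : ℕ) :
    HistoryBankingSharpShares.sBsharp { O with γ₀ := lam₀ ^ 2 * O.γ₀ } m C (gsOf D g₀ K) j d' ≤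
      lam₀ ^ 2 * B16HistoryStepJunction.sBsharp (runsOf D g₀) c K j d' := by
  rw [sBsharp_live]
  exact mul_le_mul_of_nonneg_left (hsB_of_tables D g₀ O m C c hγ hA hp hγ0 hm K j d') (sq_nonneg _)

end Slots

section End

variable {F : T4Family} {N : ℕ} [NeZero N] {ℰ : LoopAverage (Matrix.specialUnitaryGroup (Fin N) ℂ)}

/-- **THE END AT THE TOWER (ROUNDED RENEWAL PIN), AT ROAD (δ)'s LIVE LETTERS.**  For (0.4)-block-averaged data on `SU(N)`
with a measurable small-loop average, GIVEN (B) and `BetaPertHyp` BY NAME, the sign conventions and the `_fsc` family's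
constants-only side conditions AT PRINT's LETTERS (`ThresholdOK C …`, the slack `C.a + (θ + θv) ≤ ½γ₀A₁²`, …), and — for
all small-coupling tuned runs and every loop string — SOME tower-form record OF THE LOWERED-THRESHOLD RUN, i.e. a record at
the live letters `TowerReadDataLWR D {C with a := λ₀²a} {O with γ₀ := λ₀²γ₀} (λ₀²θv) …` (renewal pin unchanged by
`sRrnd_live`, birth floor `λ₀²·sBsharp`), the headline predicate `ContinuumYM4Torus D` holds.  Proof: the owner's
`continuumYM4Torus_of_towerReadingLWR_fsc` AT the live letters, `ThresholdOK` and the slack supplied by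
`LiveFactorEndLetters.thresholdOK_live` ∕ `slack_live`, every other side condition letter-blind.  CONDITIONAL on everything
the live record displays (node O's to inhabit); NE7c ∕ NE7b NOT proved; count 0∕9. [folklore] -/
theorem continuumYM4Torus_of_towerReadingLWR_live (D : FiniteEpsData F (Matrix.specialUnitaryGroup (Fin N) ℂ))
    (hBA : D.IsBlockAveraged ℰ) (hE : ℰ.MeasurableE)
    (hB : B16.EndStatementBPrinted D.C) (hβ : BetaPertHyp D.βfun) (hsign : B16.SignConventions D.C)
    {lam₀ : ℝ} (h0 : 0 < lam₀)
    {C : T4PrintedShapeBanking.Consts} {O : PrintedO1s}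
    {rr : ℕ} {β₀ : ℝ} (h : ThresholdOK C F.L rr β₀) (hμ : 0 < C.μ) (d n : ℕ)
    (hκ₁ : (d : ℝ) * Real.log F.L + 2 * Real.log 2 ≤ C.κ₁) (hE₀ : Real.log (2 + birthMass C) ≤ C.E₀)
    (hA₀ : 1 ≤ C.A₀) (hβ₀ : 0 < β₀) (hLβ : (F.L : ℝ) * β₀ ≤ 1) (hn₁ : 13 ≤ C.n₁) (hn : 0 < n)
    {θ θv : ℝ} (hθ : 0 < θ) (hslack : C.a + (θ + θv) ≤ O.γ₀ * O.A₁ ^ 2 / 2)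
    (hE₂ : 0 < C.E₂) (hE₃ : 0 ≤ C.E₃) {sS : ℕ} (hsS : 1 ≤ sS)
    (hsmall : (((2 * cth 32 1 sS + 1) ^ d : ℕ) : ℝ) * (5 : ℝ) ^ d * ((max 1 (2 * 32 + 2) : ℕ) : ℝ) ≤
      (F.L : ℝ) ^ (sS / 2) / 2)
    {θc : ℝ} (hθc0 : 0 ≤ θc) (hθc1 : θc < 1) (hθcs : 1 / 2 ≤ θc ^ sS)
    {cΛ M Φ b₀ : ℝ} {p₁ η η' κ κ₂ κᵥ : ℕ}
    (hRead : T4ContinuumYM4Torus.ForSmallCouplings D fun g₀ => ∀ os : List (ULoop F),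
        ∃ (P : Type) (_ : DecidableEq P) (X : ℕ → ℕ → Type) (𝒢 : (K j : ℕ) → GoodClass (X K j))
          (_ : ∀ K, MeasurableSpace (X K K)) (μ : (K : ℕ) → Measure (X K K)) (_ : ∀ K, IsFiniteMeasure (μ K))
          (DomK' : ℕ → Type) (I' : (K : ℕ) → HIndex (DomK' K))
          (Y : ℕ → Type) (_ : ∀ K, MeasurableSpace (Y K)) (νB : (K : ℕ) → Measure (Y K))
          (_ : ∀ K, IsFiniteMeasure (νB K)) (𝒢' : (K : ℕ) → GoodClass (Y K)),
          Nonempty (TowerReadDataLWR D { C with a := lam₀ ^ 2 * C.a } { O with γ₀ := lam₀ ^ 2 * O.γ₀ } (lam₀ ^ 2 * θv)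
            rr d n hn g₀ os cΛ M Φ b₀ p₁ η η' κ κ₂ κᵥ P X 𝒢 μ I' Y νB 𝒢')) :
    T4ContinuumYM4Torus.ContinuumYM4Torus D :=
  continuumYM4Torus_of_towerReadingLWR_fsc D hBA hE hB hβ hsign (thresholdOK_live h0 h) hμ d n hκ₁ hE₀ hA₀ hβ₀ hLβ hn₁
    hn (slack_pos_live h0 hθ) (slack_live C O hslack) hE₂ hE₃ hsS hsmall hθc0 hθc1 hθcs hRead

end End

end

end Summit.QuantumFields.BalabanUV.T4Continuum.Spine.NE7c.LiveFactorEndApplied
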